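import Literature.Probability.RandomPlanarGeometry.SAWCountZdSymbolSameBlockStatistics
import Literature.Probability.RandomPlanarGeometry.SAWCountZdSymbolLetterConditions
import Literature.Probability.RandomPlanarGeometry.SAWCountZdSymbolSecondTopCount
import HarnessLib

/-!
# THE SECOND-LOWEST CORNER OF EVERY LAYER: `M_j(m, m−4)` for all `j + 2 ≤ m` — five-run and split classes in associated-Stirling form

Topic `Literature/Probability/RandomPlanarGeometry` (the «SYMBOL POLYNOMIALITY» programme; on the all-layer statistics `SAWCountZdSymbolLowestCorner.lean` (car H:
`card_abData_eq_sum`, `card_shapeClass_topVec_eq_sum`), `SAWCountZdSymbolBlockStatistics.lean` (car I: `card_abData_filter_snd_eq_sum`), `SAWCountZdSymbolSameBlockStatistics.lean`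
(car J: `card_abData_filter_same_eq_sum`), the every-`m` class identities of `SAWCountZdSymbolLetterConditions.lean` (a-p1 g27 L: ★★ `card_shapeClass_fiveVec_add`,
`card_filter_letter_eq/rev`, `card_goodParts_filter_blockOf_base/succ/outer`), `SAWCountZdSymbolSplitRun.lean` (6b: `shapeClass_splitVec_eq_filter`, `sep_facts`) and the
classification `SAWCountZdSymbolSecondTopCount.lean` (6c: ★ `exists_eq_fiveVec_or_splitVec`, `splitIdx`, `fiveVec_inj`, `splitVec_inj`, `fiveVec_ne_splitVec`) — all valid for every
word length `m`).

PRINTED CONTEXT (locators only). Madras–Slade (1993) §1.1 eq. (1.1.8) p. 5, Definition 1.2.4, §1.2 p. 10; Clisby–Liang–Slade (2007) §3.3 eqs. (29)/(31); Charalambides (2018) Ch. 2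
Exercise 32 (associated Stirling numbers `T`).

THE THEOREM (FINDING-ZD-SYMBOL-POLYNOMIALITY §21 (v), there a conjecture with fifteen census retrodictions and the blind HITs Am. BV-6/7; HERE PROVED). On `m` letters the classes
with `m − 4` breaks are (6c) the `m − 4` FIVE-RUN classes `fiveVec m s` and the `(m−4)(m−5)` SPLIT classes `splitVec m i q`; with `n = m − 4`, `k = m − j − 2` and the three
(A, B, ρ) statistics `AB = Σ_e 2^e C(n,e) T(n−e,k)` (`secondLowestAB`), `N_tied = Σ_t 2^t C(n−1,t) T(n−1−t,k)` (`secondLowestTied`), `N_same = Σ_t 2^t C(n−2,t)(2T(n−2−t,k) +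
S(n−t,k))` (`secondLowestSame`): ★★ `card_shapeClass_fiveVec_eq_sum`: **`#five + 3·N_tied·2^{m−3} = 2·AB·2^{m−2}`** (two windows minus three tied-letter families), ★★
`card_shapeClass_splitVec_eq_sum`: **`#split + N_same·2^{m−3} = AB·2^{m−2}`** (a window minus its reversal pairs), hence ★★★ `secondLowestShapeSum_add`: for every `j + 2 ≤ m`,
`5 ≤ m`, **`M_j(m, m−4) + (m−4)·3N_tied·2^{m−3} + (m−4)(m−5)·N_same·2^{m−3} = (m−4)·2AB·2^{m−2} + (m−4)(m−5)·AB·2^{m−2}`** — the SECOND-LOWEST corner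
of EVERY layer. It
re-derives U′_j (`secondLowestShapeSum_eq_secondShapeSumTop`, m = 2j) and X′_j (`_eq_thirdShapeSumMid`, m = 2j−1), and ★ `secondLowestShapeSum_values`: `3456 = U′_4`, `137920 = X′_5`,
`87040 = M₇(9,5)`, `491520 = M₈(10,6)`, `261632000 = M₇(12,8)`, `6079997952 = M₈(13,9)` (lane censuses §17/§18) and the j = 9 cells **`321536000 = M₉(12,8)`, `9668201472 = M₉(13,9)`**
— blind-registered (Am. BV-6/7, sealed 605fac2a2983739d) and HIT by kit j314094 before this proof; now theorem instances. Tool notions (the lane's): `secondLowestAB`, `secondLowestTied`,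
`secondLowestSame`, `secondLowestShapeSum`.

THIS FILE (lane «pcv-sawmu», a-p1 g27; all PROVED, standard axioms): `secondLowestAB`, `secondLowestTied`, `secondLowestSame`, ★ `card_abData_filter_fst_eq_snd`,
`outer_mem_four` (private), `outer_mem_pred` (private), `outer_mem_sep` (private), ★★ `card_shapeClass_fiveVec_eq_sum`, ★★ `card_shapeClass_splitVec_eq_sum`, `secondLowestShapeSum`,
★★★ `secondLowestShapeSum_add`, `secondLowestShapeSum_eq_secondShapeSumTop`, `secondLowestShapeSum_eq_thirdShapeSumMid`, ★ `secondLowestShapeSum_values`.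
[cite: MadrasSlade1993, §1.1 eq. (1.1.8) p. 5; Definition 1.2.4; §1.2 (p. 10)] [cite: ClisbyLiangSlade2007, §3.3 eqs. (29)/(31)]
[cite: Charalambides2018, Ch. 2 Exercise 32 (associated Stirling numbers of the second kind)]

Provenance: lane «pcv-sawmu», a-p1 g27 (2026-08-28).
-/

open Finset
open scoped BigOperators
open Literature.Probability.LatticeModels
open Literature.Probability.RandomPlanarGeometry.SAW
open Literature.Probability.Percolation

namespace Literature.Probability.RandomPlanarGeometry.SAW.Zd

namespace WordTypes

variable {m : ℕ}

/-! ### The three statistics -/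

/-- `AB(m,j) = Σ_e 2^e C(m−4,e) T(m−4−e, m−j−2)` — the (A, B, ρ) count of a one-block window (car H). [cite: MadrasSlade1993, Definition 1.2.4; lane tool notion] -/
def secondLowestAB (m j : ℕ) : ℕ := ∑ e ∈ Finset.range (m - 4 + 1), 2 ^ e * (m - 4).choose e * assocStirling (m - 4 - e) (m - j - 2)

/-- `N_tied(m,j) = Σ_t 2^t C(m−5,t) T(m−5−t, m−j−2)` — an outer letter tied to a block axis (car I). [cite: MadrasSlade1993, Definition 1.2.4; lane tool notion] -/
def secondLowestTied (m j : ℕ) : ℕ := ∑ t ∈ Finset.range (m - 4), 2 ^ t * (m - 5).choose t * assocStirling (m - 5 - t) (m - j - 2)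

/-- `N_same(m,j) = Σ_t 2^t C(m−6,t)(2T(m−6−t,k) + S(m−4−t,k))`, `k = m − j − 2` — two outer positions together (car J). [cite: MadrasSlade1993, Definition 1.2.4; lane tool notion] -/
def secondLowestSame (m j : ℕ) : ℕ :=
  ∑ t ∈ Finset.range (m - 5), 2 ^ t * (m - 6).choose t * (2 * assocStirling (m - 6 - t) (m - j - 2) + sameBlockT (m - 4 - t) (m - j - 2))

open Classical in
/-- ★ The (A, B) symmetry of the block data: `#{(A,B,ρ) | o ∈ A} = #{(A,B,ρ) | o ∈ B}` (swap `A` and `B`). [cite: MadrasSlade1993, Definition 1.2.4; lane lemma] -/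
theorem card_abData_filter_fst_eq_snd {j p : ℕ} (hp : p + 4 ≤ m) (o : Fin m) :
    ((abData m j p hp).filter fun d => o ∈ d.1.1).card = ((abData m j p hp).filter fun d => o ∈ d.1.2).card := by
  have hmem : ∀ d : (Σ _ : Finset (Fin m) × Finset (Fin m), Finset (Finset (Fin m))), d ∈ abData m j p hp →
      (⟨(d.1.2, d.1.1), d.2⟩ : Σ _ : Finset (Fin m) × Finset (Fin m), Finset (Finset (Fin m))) ∈ abData m j p hp := by
    intro d hd
    unfold abData at hd ⊢
    rw [Finset.mem_sigma, Finset.mem_filter, Finset.mem_product] at hd ⊢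
    obtain ⟨⟨⟨hA, hB⟩, hdj⟩, hρ⟩ := hd
    refine ⟨⟨⟨hB, hA⟩, hdj.symm⟩, ?_⟩
    dsimp only
    rw [Finset.union_comm]; exact hρ
  refine Finset.card_nbij' (fun d => ⟨(d.1.2, d.1.1), d.2⟩) (fun d => ⟨(d.1.2, d.1.1), d.2⟩) (fun d hd => ?_) (fun d hd => ?_) (fun d _ => rfl) (fun d _ => rfl)
  · rw [Finset.mem_coe, Finset.mem_filter] at hd ⊢; exact ⟨hmem d hd.1, hd.2⟩
  · rw [Finset.mem_coe, Finset.mem_filter] at hd ⊢; exact ⟨hmem d hd.1, hd.2⟩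

/-! ### Outer positions next to a window -/

/-- `s + 4` is an outer (and free) position of the window at `s`, distinct from `s` and `s + 1`. [cite: MadrasSlade1993, Definition 1.2.4; lane plumbing] -/
private theorem outer_mem_four {s : ℕ} (hs : s + 5 ≤ m) :
    (⟨s + 4, by omega⟩ : Fin m) ∈ outerPos m s (by omega) ∧ (⟨s + 4, by omega⟩ : Fin m) ∈ freePos m s ∧
      (⟨s + 1, by omega⟩ : Fin m) ≠ ⟨s + 4, by omega⟩ ∧ (⟨s, by omega⟩ : Fin m) ≠ ⟨s + 4, by omega⟩ := by
  have hF : (⟨s + 4, by omega⟩ : Fin m) ∈ freePos m s := by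
    unfold freePos; simp only [Finset.mem_filter, Finset.mem_univ, true_and]; omega
  refine ⟨(mem_outerPos (by omega)).2 ⟨hF, by show s + 4 ≠ s; omega, by show s + 4 ≠ s + 1; omega⟩, hF, by simp [Fin.ext_iff], by simp [Fin.ext_iff]⟩

/-- `s` is an outer (and free) position of the window at `s + 1`. [cite: MadrasSlade1993, Definition 1.2.4; lane plumbing] -/
private theorem outer_mem_pred {s : ℕ} (hs : s + 5 ≤ m) :
    (⟨s, by omega⟩ : Fin m) ∈ outerPos m (s + 1) (by omega) ∧ (⟨s, by omega⟩ : Fin m) ∈ freePos m (s + 1) ∧ (⟨s + 1, by omega⟩ : Fin m) ≠ ⟨s, by omega⟩ := by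
  have hF : (⟨s, by omega⟩ : Fin m) ∈ freePos m (s + 1) := by
    unfold freePos; simp only [Finset.mem_filter, Finset.mem_univ, true_and]; omega
  refine ⟨(mem_outerPos (by omega)).2 ⟨hF, by show s ≠ s + 1; omega, by show s ≠ s + 1 + 1; omega⟩, hF, by simp [Fin.ext_iff]⟩

/-- For a separated adjacency `q`, both `q` and `q + 1` are outer positions of the window at `i`. [cite: MadrasSlade1993, Definition 1.2.4; lane plumbing] -/
private theorem outer_mem_sep {i q : ℕ} (hi : i + 4 ≤ m) (hq : SepAdj m i q) :
    (⟨q, by unfold SepAdj at hq; omega⟩ : Fin m) ∈ outerPos m i hi ∧ (⟨q + 1, by unfold SepAdj at hq; omega⟩ : Fin m) ∈ outerPos m i hi ∧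
      (⟨q, by unfold SepAdj at hq; omega⟩ : Fin m) ≠ ⟨q + 1, by unfold SepAdj at hq; omega⟩ := by
  obtain ⟨hqB, hq1B, hqF, hq1F⟩ := sep_facts hq
  unfold InB at hqB hq1B
  simp only [not_and_or, not_le] at hqB hq1B
  refine ⟨(mem_outerPos hi).2 ⟨hqF, ?_, ?_⟩, (mem_outerPos hi).2 ⟨hq1F, ?_, ?_⟩, by simp [Fin.ext_iff]⟩ <;> simp only <;> omega

/-! ### The two class counts -/

open Classical in
/-- ★★ THE FIVE-RUN CLASS FOR EVERY `m`: `#shapeClass j m (fiveVec m s) + 3·N_tied·2^{m−3} = 2·AB·2^{m−2}` (`s + 5 ≤ m`, `j + 2 ≤ m`) — car L's identity (two windows minus the three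
tied-letter families), each family an outer letter tied to a block axis. [cite: MadrasSlade1993, Definition 1.2.4; lane theorem] -/
theorem card_shapeClass_fiveVec_eq_sum {j s : ℕ} (hs : s + 5 ≤ m) (hmj : j + 2 ≤ m) :
    (shapeClass j m (fiveVec m s)).card + 3 * (secondLowestTied m j * 2 ^ (m - 3)) = 2 * (secondLowestAB m j * 2 ^ (m - 2)) := by
  have hadd := card_shapeClass_fiveVec_add (j := j) hs
  obtain ⟨hO4, hF4, hne14, hne04⟩ := outer_mem_four (m := m) hs
  obtain ⟨hOp, hFp, hne⟩ := outer_mem_pred (m := m) hs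
  have hp0 : s + 4 ≤ m := by omega
  have hp1 : s + 1 + 4 ≤ m := by omega
  -- the three families
  have e1 : ((shapeClass j m (topVec m s)).filter fun κ => κ ⟨s + 4, by omega⟩ = κ ⟨s + 1, by omega⟩).card = secondLowestTied m j * 2 ^ (m - 3) := by
    rw [card_filter_letter_eq hp0 (p_mem_freePos hp0).2 hF4 hne14, card_goodParts_filter_blockOf_succ hp0 hmj hO4, card_abData_filter_snd_eq_sum hp0 hO4, secondLowestTied]
  have e2 : ((shapeClass j m (topVec m (s + 1))).filter fun κ => κ ⟨s, by omega⟩ = ((κ ⟨s + 1, by omega⟩).1, !(κ ⟨s + 1, by omega⟩).2)).card =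
      secondLowestTied m j * 2 ^ (m - 3) := by
    rw [card_filter_letter_rev hp1 (p_mem_freePos hp1).1 hFp hne, card_goodParts_filter_blockOf_base hp1 hmj hOp, card_abData_filter_fst_eq_snd,
      card_abData_filter_snd_eq_sum hp1 hOp, secondLowestTied]
  have e3 : ((shapeClass j m (topVec m s)).filter fun κ => κ ⟨s + 4, by omega⟩ = κ ⟨s, by omega⟩).card = secondLowestTied m j * 2 ^ (m - 3) := by
    rw [card_filter_letter_eq hp0 (p_mem_freePos hp0).1 hF4 hne04, card_goodParts_filter_blockOf_base hp0 hmj hO4, card_abData_filter_fst_eq_snd,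
      card_abData_filter_snd_eq_sum hp0 hO4, secondLowestTied]
  rw [e1, e2, e3, card_shapeClass_topVec_eq_sum hp0 hmj, card_shapeClass_topVec_eq_sum hp1 hmj] at hadd
  unfold secondLowestAB
  omega

open Classical in
/-- ★★ THE SPLIT CLASS FOR EVERY `m`: `#shapeClass j m (splitVec m i q) + N_same·2^{m−3} = AB·2^{m−2}` (`i + 4 ≤ m`, `q` separated, `j + 2 ≤ m`) — the window minus its reversal
pairs at `(q, q+1)`, two outer positions together. [cite: MadrasSlade1993, Definition 1.2.4; lane theorem] -/
theorem card_shapeClass_splitVec_eq_sum {j i q : ℕ} (hi : i + 4 ≤ m) (hq : SepAdj m i q) (hmj : j + 2 ≤ m) :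
    (shapeClass j m (splitVec m i q)).card + secondLowestSame m j * 2 ^ (m - 3) = secondLowestAB m j * 2 ^ (m - 2) := by
  obtain ⟨hqO, hq1O, hne⟩ := outer_mem_sep hi hq
  obtain ⟨-, -, hqF, hq1F⟩ := sep_facts hq
  have hrev : ((shapeClass j m (topVec m i)).filter fun κ =>
      κ ⟨q + 1, by unfold SepAdj at hq; omega⟩ = ((κ ⟨q, by unfold SepAdj at hq; omega⟩).1, !(κ ⟨q, by unfold SepAdj at hq; omega⟩).2)).card =
      secondLowestSame m j * 2 ^ (m - 3) := by
    rw [card_filter_letter_rev hi hqF hq1F hne, card_goodParts_filter_blockOf_outer hi hmj hqO hq1O, card_abData_filter_same_eq_sum hi hqO hq1O hne, secondLowestSame]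
  have h := Finset.card_filter_add_card_filter_not (s := shapeClass j m (topVec m i))
    (fun κ => κ ⟨q + 1, by unfold SepAdj at hq; omega⟩ = ((κ ⟨q, by unfold SepAdj at hq; omega⟩).1, !(κ ⟨q, by unfold SepAdj at hq; omega⟩).2))
  rw [hrev, card_shapeClass_topVec_eq_sum hi hmj, ← shapeClass_splitVec_eq_filter hi hq] at h
  unfold secondLowestAB
  omega

/-! ### The second-lowest corner of every layer -/

open Classical in
/-- The SECOND-LOWEST-CORNER SUM `M_j(m, m−4) = Σ_{A valid on m letters, breaks A = m − 4} #shapeClass_j(m, A)` (`m = 2j, 2j − 1, 2j − 2, …` are `U′_j`, `X′_j`, the fourth layer's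
second corner, …). [cite: MadrasSlade1993, Definition 1.2.4; lane tool notion] -/
noncomputable def secondLowestShapeSum (j m : ℕ) : ℕ :=
  ∑ A : Fin m → Bool, if AdjValid A ∧ breaks A = m - 4 then (shapeClass j m A).card else 0

open Classical in
/-- ★★★ THE SECOND-LOWEST CORNER OF EVERY LAYER: for `j + 2 ≤ m`, `5 ≤ m`,
`M_j(m, m−4) + (m−4)·3N_tied·2^{m−3} + (m−4)(m−5)·N_same·2^{m−3} = (m−4)·2AB·2^{m−2} + (m−4)(m−5)·AB·2^{m−2}` — the `m − 4` five-run classes and the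
`(m−4)(m−5)` split
classes (6c's classification, every `m`), each counted above. [cite: MadrasSlade1993, §1.1 eq. (1.1.8) p. 5; Definition 1.2.4] [cite: ClisbyLiangSlade2007, §3.3 eqs. (29)/(31)]
[cite: Charalambides2018, Ch. 2 Exercise 32; lane theorem] -/
theorem secondLowestShapeSum_add {j : ℕ} (hmj : j + 2 ≤ m) (hm : 5 ≤ m) :
    secondLowestShapeSum j m + ((m - 4) * (3 * (secondLowestTied m j * 2 ^ (m - 3))) + (m - 4) * (m - 5) * (secondLowestSame m j * 2 ^ (m - 3))) =
      (m - 4) * (2 * (secondLowestAB m j * 2 ^ (m - 2))) + (m - 4) * (m - 5) * (secondLowestAB m j * 2 ^ (m - 2)) := by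
  unfold secondLowestShapeSum
  set f : (Fin m → Bool) → ℕ := fun A => if AdjValid A ∧ breaks A = m - 4 then (shapeClass j m A).card else 0 with hf
  set I5 := (Finset.range (m - 4)).image (fiveVec m) with hI5
  set I42 := ((Finset.range (m - 4)).offDiag).image (fun ab => splitVec m (splitIdx ab).1 (splitIdx ab).2) with hI42
  -- every other vector contributes nothing
  have hvan : ∀ A ∈ (Finset.univ : Finset (Fin m → Bool)), A ∉ I5 ∪ I42 → f A = 0 := by
    intro A _ hA
    rw [hf]; simp only
    split_ifs with h
    · by_contra hne
      obtain ⟨κ, hκ⟩ := Finset.card_pos.1 (Nat.pos_of_ne_zero hne)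
      rcases exists_eq_fiveVec_or_splitVec (by rw [h.2]; omega) h.1 hκ with ⟨s, hs, rfl⟩ | ⟨ab, hab, rfl⟩
      · exact hA (Finset.mem_union_left _ (Finset.mem_image.2 ⟨s, Finset.mem_range.2 (by omega), rfl⟩))
      · exact hA (Finset.mem_union_right _ (Finset.mem_image.2 ⟨ab, hab, rfl⟩))
    · rfl
  have hdisj : Disjoint I5 I42 := by
    rw [Finset.disjoint_left]
    intro A h5 h42
    obtain ⟨s, hs, rfl⟩ := Finset.mem_image.1 h5
    obtain ⟨ab, hab, heq⟩ := Finset.mem_image.1 h42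
    obtain ⟨hi, hsep⟩ := splitIdx_sepAdj hab
    exact fiveVec_ne_splitVec hi hsep heq.symm
  have hinj5 : Set.InjOn (fiveVec m) ↑(Finset.range (m - 4)) := by
    intro s hs s' hs' h
    rw [Finset.mem_coe, Finset.mem_range] at hs hs'
    exact fiveVec_inj (by omega) (by omega) h
  have hinj42 : Set.InjOn (fun ab => splitVec m (splitIdx ab).1 (splitIdx ab).2) ↑((Finset.range (m - 4)).offDiag) := by
    intro ab hab ab' hab' h
    rw [Finset.mem_coe] at hab hab'
    obtain ⟨hi, hsep⟩ := splitIdx_sepAdj hab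
    obtain ⟨hi', hsep'⟩ := splitIdx_sepAdj hab'
    obtain ⟨h1, h2⟩ := splitVec_inj hi hsep hi' hsep' h
    exact splitIdx_inj hab hab' (Prod.ext h1 h2)
  -- the values on the two families
  have hval5 : ∀ s ∈ Finset.range (m - 4), f (fiveVec m s) + 3 * (secondLowestTied m j * 2 ^ (m - 3)) = 2 * (secondLowestAB m j * 2 ^ (m - 2)) := by
    intro s hs
    rw [Finset.mem_range] at hs
    rw [hf]; simp only
    rw [if_pos ⟨adjValid_fiveVec (by omega), (breaks_fiveVec (by omega)).trans (by omega)⟩]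
    exact card_shapeClass_fiveVec_eq_sum (by omega) hmj
  have hval42 : ∀ ab ∈ (Finset.range (m - 4)).offDiag,
      f (splitVec m (splitIdx ab).1 (splitIdx ab).2) + secondLowestSame m j * 2 ^ (m - 3) = secondLowestAB m j * 2 ^ (m - 2) := by
    intro ab hab
    obtain ⟨hi, hsep⟩ := splitIdx_sepAdj hab
    rw [hf]; simp only
    rw [if_pos ⟨adjValid_splitVec hi hsep, (breaks_splitVec hi hsep).trans (by omega)⟩]
    exact card_shapeClass_splitVec_eq_sum hi hsep hmj
  -- assemble
  have hcard : ((Finset.range (m - 4)).offDiag).card = (m - 4) * (m - 5) := by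
    rw [Finset.offDiag_card, Finset.card_range, ← Nat.mul_sub_one]
    congr 1
  have step1 : ∑ A, f A = ∑ s ∈ Finset.range (m - 4), f (fiveVec m s) +
      ∑ ab ∈ (Finset.range (m - 4)).offDiag, f (splitVec m (splitIdx ab).1 (splitIdx ab).2) := by
    rw [← Finset.sum_subset (Finset.subset_univ _) hvan, Finset.sum_union hdisj, Finset.sum_image hinj5, Finset.sum_image hinj42]
  rw [show (∑ A, f A) = Finset.univ.sum f from rfl] at step1
  show Finset.univ.sum f + _ = _
  rw [step1]
  set S5 := ∑ s ∈ Finset.range (m - 4), f (fiveVec m s) with hS5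
  set S42 := ∑ ab ∈ (Finset.range (m - 4)).offDiag, f (splitVec m (splitIdx ab).1 (splitIdx ab).2) with hS42
  set X := secondLowestTied m j * 2 ^ (m - 3) with hX
  set Y := secondLowestSame m j * 2 ^ (m - 3) with hY
  set Z := secondLowestAB m j * 2 ^ (m - 2) with hZ
  have step2 : S5 + (m - 4) * (3 * X) = (m - 4) * (2 * Z) := by
    rw [hS5, show (m - 4) * (3 * X) = ∑ s ∈ Finset.range (m - 4), 3 * X by rw [Finset.sum_const, Finset.card_range, smul_eq_mul],
      ← Finset.sum_add_distrib, Finset.sum_congr rfl (fun s hs => hval5 s hs), Finset.sum_const, Finset.card_range, smul_eq_mul]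
  have step3 : S42 + ((Finset.range (m - 4)).offDiag).card * Y = ((Finset.range (m - 4)).offDiag).card * Z := by
    rw [hS42, show ((Finset.range (m - 4)).offDiag).card * Y = ∑ ab ∈ (Finset.range (m - 4)).offDiag, Y by rw [Finset.sum_const, smul_eq_mul],
      ← Finset.sum_add_distrib, Finset.sum_congr rfl (fun ab hab => hval42 ab hab), Finset.sum_const, smul_eq_mul]
  rw [hcard] at step3
  omega

/-! ### Cross-checks: layers 2 and 3, the censuses, and the `j = 9` cells -/

/-- Layer 2: `secondLowestShapeSum j (2j) = U′_j` (`secondShapeSumTop`). [cite: MadrasSlade1993, Definition 1.2.4; lane plumbing] -/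
theorem secondLowestShapeSum_eq_secondShapeSumTop (j : ℕ) : secondLowestShapeSum j (2 * j) = secondShapeSumTop j := by
  unfold secondLowestShapeSum secondShapeSumTop; rfl

/-- Layer 3: `secondLowestShapeSum j (2j−1) = X′_j` (`thirdShapeSumMid`). [cite: MadrasSlade1993, Definition 1.2.4; lane plumbing] -/
theorem secondLowestShapeSum_eq_thirdShapeSumMid (j : ℕ) : secondLowestShapeSum j (2 * j - 1) = thirdShapeSumMid j := by
  unfold secondLowestShapeSum thirdShapeSumMid
  exact Finset.sum_congr rfl fun A _ => by rw [show 2 * j - 1 - 4 = 2 * j - 5 by omega]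

/-- ★ VALUES: `U′_4 = 3456`, `X′_5 = 137920`; the census cells `M₇(9,5) = 87040`, `M₈(10,6) = 491520`, `M₇(12,8) = 261632000`, `M₈(13,9) = 6079997952` (FINDING §17/§18); and the
`j = 9` cells `M₉(12,8) = 321536000`, `M₉(13,9) = 9668201472` (Am. BV-6/7: blind HIT by kit j314094, now theorem instances). [cite: MadrasSlade1993, Definition 1.2.4; lane theorem] -/
theorem secondLowestShapeSum_values :
    secondLowestShapeSum 4 8 = 3456 ∧ secondLowestShapeSum 5 9 = 137920 ∧ secondLowestShapeSum 7 9 = 87040 ∧ secondLowestShapeSum 8 10 = 491520 ∧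
      secondLowestShapeSum 7 12 = 261632000 ∧ secondLowestShapeSum 8 13 = 6079997952 ∧ secondLowestShapeSum 9 12 = 321536000 ∧ secondLowestShapeSum 9 13 = 9668201472 := by
  have h1 := secondLowestShapeSum_add (j := 4) (m := 8) (by norm_num) (by norm_num)
  have h2 := secondLowestShapeSum_add (j := 5) (m := 9) (by norm_num) (by norm_num)
  have h3 := secondLowestShapeSum_add (j := 7) (m := 9) (by norm_num) (by norm_num)
  have h4 := secondLowestShapeSum_add (j := 8) (m := 10) (by norm_num) (by norm_num)
  have h5 := secondLowestShapeSum_add (j := 7) (m := 12) (by norm_num) (by norm_num)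
  have h6 := secondLowestShapeSum_add (j := 8) (m := 13) (by norm_num) (by norm_num)
  have h7 := secondLowestShapeSum_add (j := 9) (m := 12) (by norm_num) (by norm_num)
  have h8 := secondLowestShapeSum_add (j := 9) (m := 13) (by norm_num) (by norm_num)
  rw [show secondLowestAB 8 4 = 3 by decide, show secondLowestTied 8 4 = 0 by decide, show secondLowestSame 8 4 = 1 by decide] at h1
  rw [show secondLowestAB 9 5 = 40 by decide, show secondLowestTied 9 5 = 3 by decide, show secondLowestSame 9 5 = 10 by decide] at h2
  rw [show secondLowestAB 9 7 = 32 by decide, show secondLowestTied 9 7 = 16 by decide, show secondLowestSame 9 7 = 16 by decide] at h3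
  rw [show secondLowestAB 10 8 = 64 by decide, show secondLowestTied 10 8 = 32 by decide, show secondLowestSame 10 8 = 32 by decide] at h4
  rw [show secondLowestAB 12 7 = 3850 by decide, show secondLowestTied 12 7 = 315 by decide, show secondLowestSame 12 7 = 640 by decide] at h5
  rw [show secondLowestAB 13 8 = 35938 by decide, show secondLowestTied 13 8 = 3850 by decide, show secondLowestSame 13 8 = 5936 by decide] at h6
  rw [show secondLowestAB 12 9 = 5281 by decide, show secondLowestTied 12 9 = 1611 by decide, show secondLowestSame 12 9 = 1675 by decide] at h7
  rw [show secondLowestAB 13 9 = 59508 by decide, show secondLowestTied 13 9 = 11655 by decide, show secondLowestSame 13 9 = 13266 by decide] at h8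
  norm_num at h1 h2 h3 h4 h5 h6 h7 h8
  omega

end WordTypes

end Literature.Probability.RandomPlanarGeometry.SAW.Zd
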